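import Literature.RepresentationTheory.HeisenbergGroup.SchrodingerCommutant
import Literature.NumberTheory.Automorphic.LocalPiSchwartzBruhatFourier
import HarnessLib

/-!
# Rank `n`: the commutant of the smooth Schrödinger model on `𝒮(F^ι)` is `ℂ`; implementers are unique up to a scalar

Topic `RepresentationTheory/HeisenbergGroup`; namespace `Literature.RepresentationTheory.HeisenbergGroup`.

KERNEL throughout; no records. `F` a non-archimedean local field, `ι` a finite index type, `ψ` continuous
non-trivial (conductor `𝔭^m`), `ρ = schrodingerSB (dotProductBilin F F) ψ` the smooth Schrödinger model of the
Heisenberg group of `W = F^ι ⊕ F^ι` on `𝒮(F^ι)`: `(ρ((x,y),t) Φ)(u) = ψ(t + ⟨u, y⟩) Φ(u + x)`. This is the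
several-variables twin of `SchrodingerCommutant.lean` (rank one, `ι = pt`), with the boxes `(𝔭^N)^ι` of
`LocalPiSchwartzBruhatFourier.lean` in place of the balls `𝔭^N`:
* §1 **the commutant** (`commutant_schrodingerSB_pi`): a `ℂ`-linear `T : 𝒮(F^ι) → 𝒮(F^ι)` commuting with every
  `ρ(h)` is a scalar (MVW Chap. 2 I.3's argument made finite: `T 1_{(𝔭^N)^ι}` is fixed by the modulations
  `y ∈ (𝔭^{m-N})^ι` — hence vanishes off `(𝔭^N)^ι`, testing with `y = y₀ e_i` and the conductor — and by the
  translations `x ∈ (𝔭^N)^ι` — hence is constant on the box; then the step decomposition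
  `Φ = Σ_B Φ(a_B) ρ(-a_B, 0, 0) 1_{(𝔭^N)^ι}`);
* §2 **uniqueness of implementers up to a scalar** (`implementerUniqueUpToScalar_schrodingerSB_pi`): MVW II.1
  "`M` est unique à un scalaire près", KERNEL in every finite rank, and `ker p = im i` for
  `1 → ℂˣ → S̃p_ψ(W) → Sp(W)`.

## References

* [MoeglinVignerasWaldspurger1987] C. Mœglin, M.-F. Vignéras, J.-L. Waldspurger, *Correspondances de Howe sur un
  corps p-adique*, LNM 1291 (1987), Chap. 2 I.3–I.4, II.1.
-/

set_option autoImplicit false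

noncomputable section

namespace Literature.RepresentationTheory.HeisenbergGroup

open _root_.MeasureTheory
open Literature.NumberTheory.Automorphic
open Literature.NumberTheory.GaloisRepresentations.IsNonarchimedeanLocalField
open scoped Pointwise

section Commutant

variable {F : Type*} [Field F] [ValuativeRel F] [TopologicalSpace F] [IsNonarchimedeanLocalField F]
  {ι : Type*} [Fintype ι]
  (ψ : AddChar F Circle) (hl : IsLocallyConstant (⇑ψ : F → Circle))
  (hb : ∀ y : ι → F, Continuous fun u : ι → F => dotProductBilin F F u y)

/-- the translation `((x, 0), 0)` of the Heisenberg group of `F^ι ⊕ F^ι`. [cite: MoeglinVignerasWaldspurger1987, Chap. 2 I.3] -/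
def piTransl (x : ι → F) : Heisenberg (polar (dotProductBilin F F (m := ι))) := ⟨(x, 0), 0⟩

/-- the modulation `((0, y), 0)` of the Heisenberg group of `F^ι ⊕ F^ι`. [cite: MoeglinVignerasWaldspurger1987, Chap. 2 I.3] -/
def piModul (y : ι → F) : Heisenberg (polar (dotProductBilin F F (m := ι))) := ⟨(0, y), 0⟩

/-- translations act by `(ρ(x,0,0) Φ)(u) = Φ(u + x)`. [cite: MoeglinVignerasWaldspurger1987, Chap. 2 I.4 Exemple (1)] -/
theorem schrodingerSB_piTransl_apply (x : ι → F) (f : SchwartzBruhat (ι → F)) (u : ι → F) :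
    ((schrodingerSB (dotProductBilin F F) ψ hl hb (piTransl x) f : SchwartzBruhat (ι → F)) : (ι → F) → ℂ) u =
      (f : (ι → F) → ℂ) (u + x) := by
  rw [schrodingerSB_apply]
  simp only [piTransl, dotProductBilin_apply_apply, dotProduct_zero, add_zero, AddChar.map_zero_eq_one,
    Circle.coe_one, one_mul]

/-- modulations act by `(ρ(0,y,0) Φ)(u) = ψ(⟨u, y⟩) Φ(u)`. [cite: MoeglinVignerasWaldspurger1987, Chap. 2 I.4 Exemple (1)] -/
theorem schrodingerSB_piModul_apply (y : ι → F) (f : SchwartzBruhat (ι → F)) (u : ι → F) :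
    ((schrodingerSB (dotProductBilin F F) ψ hl hb (piModul y) f : SchwartzBruhat (ι → F)) : (ι → F) → ℂ) u
      = (ψ (u ⬝ᵥ y) : ℂ) * (f : (ι → F) → ℂ) u := by
  rw [schrodingerSB_apply]
  simp only [piModul, dotProductBilin_apply_apply, zero_add, add_zero]

variable (F ι) in
/-- the vector `1_{(𝔭^N)^ι} ∈ 𝒮(F^ι)`. [folklore] -/
def piBallSB (N : ℤ) : SchwartzBruhat (ι → F) :=
  ⟨(piPrimePowBall F ι N).indicator fun _ => (1 : ℂ), indicator_piPrimePowBall_mem_schwartzBruhat N 1⟩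

/-- its underlying function (the characteristic function of the lattice `(𝔭^N)^ι`). [cite: WeilBNT1967, Ch. VII §2, Def. 1] -/
@[simp] theorem coe_piBallSB (N : ℤ) :
    ((piBallSB F ι N : SchwartzBruhat (ι → F)) : (ι → F) → ℂ) = (piPrimePowBall F ι N).indicator fun _ => (1 : ℂ) :=
  rfl

variable {ψ}

/-- **`T 1_{(𝔭^N)^ι} = c_N 1_{(𝔭^N)^ι}`** for `T` in the commutant, `c_N = (T 1_{(𝔭^N)^ι})(0)`: the image is fixed
by the modulations `y ∈ (𝔭^{m-N})^ι` (so vanishes off the box, by the conductor applied coordinatewise) and by the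
translations `x ∈ (𝔭^N)^ι` (so is constant on the box). [cite: MoeglinVignerasWaldspurger1987, Chap. 2 I.3] -/
theorem commutant_piBallSB {m : ℤ} (hm : ψ.HasConductorExp m)
    (T : SchwartzBruhat (ι → F) →ₗ[ℂ] SchwartzBruhat (ι → F))
    (hT : ∀ (h : Heisenberg (polar (dotProductBilin F F (m := ι)))) (f : SchwartzBruhat (ι → F)),
      T (schrodingerSB (dotProductBilin F F) ψ hl hb h f) = schrodingerSB (dotProductBilin F F) ψ hl hb h (T f))
    (N : ℤ) :
    T (piBallSB F ι N) = ((T (piBallSB F ι N) : SchwartzBruhat (ι → F)) : (ι → F) → ℂ) 0 • piBallSB F ι N := by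
  classical
  -- (1) invariance under the modulations `y ∈ (𝔭^{m-N})^ι`
  have h1 : ∀ y ∈ piPrimePowBall F ι (m - N), ∀ u,
      (ψ (u ⬝ᵥ y) : ℂ) * ((T (piBallSB F ι N) : SchwartzBruhat (ι → F)) : (ι → F) → ℂ) u
        = ((T (piBallSB F ι N) : SchwartzBruhat (ι → F)) : (ι → F) → ℂ) u := by
    intro y hy u
    have e : schrodingerSB (dotProductBilin F F) ψ hl hb (piModul y) (piBallSB F ι N) = piBallSB F ι N := by
      apply Subtype.ext
      funext v
      rw [schrodingerSB_piModul_apply, coe_piBallSB]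
      by_cases hv : v ∈ piPrimePowBall F ι N
      · have hvy : v ⬝ᵥ y ∈ primePowBall F m := by
          have := dotProduct_mem_primePowBall hv hy; rwa [add_sub_cancel] at this
        rw [hm.1 _ hvy, Circle.coe_one, one_mul]
      · rw [Set.indicator_of_notMem hv, mul_zero]
    have h := hT (piModul y) (piBallSB F ι N)
    rw [e] at h
    have h' := congr_arg (fun w : SchwartzBruhat (ι → F) => (w : (ι → F) → ℂ) u) h
    rw [schrodingerSB_piModul_apply] at h'
    exact h'.symm
  -- (2) support in `(𝔭^N)^ι`: test with `y = y₀ e_i` at a coordinate `i` with `u_i ∉ 𝔭^N`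
  have h2 : ∀ u ∉ piPrimePowBall F ι N, ((T (piBallSB F ι N) : SchwartzBruhat (ι → F)) : (ι → F) → ℂ) u = 0 := by
    intro u hu
    rw [mem_piPrimePowBall_iff] at hu
    push Not at hu
    obtain ⟨i, hi⟩ := hu
    have hi' : u i ∉ primePowBall F (m - (m - N)) := by rwa [sub_sub_cancel]
    obtain ⟨y₀, hy₀, hne⟩ := exists_mem_primePowBall_addChar_mul_ne_one hm hi'
    have h := h1 (Pi.single i y₀) (single_mem_piPrimePowBall i hy₀) u
    rw [dotProduct_single, mul_comm (u i) y₀] at h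
    have h3 : ((ψ (y₀ * u i) : ℂ) - 1) * ((T (piBallSB F ι N) : SchwartzBruhat (ι → F)) : (ι → F) → ℂ) u = 0 := by
      rw [sub_mul, one_mul, h, sub_self]
    rcases mul_eq_zero.1 h3 with h4 | h4
    · exact absurd (Circle.coe_inj.1 (by rw [Circle.coe_one]; exact sub_eq_zero.1 h4)) hne
    · exact h4
  -- (3) invariance under the translations `x ∈ (𝔭^N)^ι`
  have h3 : ∀ x ∈ piPrimePowBall F ι N, ∀ u,
      ((T (piBallSB F ι N) : SchwartzBruhat (ι → F)) : (ι → F) → ℂ) (u + x)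
        = ((T (piBallSB F ι N) : SchwartzBruhat (ι → F)) : (ι → F) → ℂ) u := by
    intro x hx u
    have e : schrodingerSB (dotProductBilin F F) ψ hl hb (piTransl x) (piBallSB F ι N) = piBallSB F ι N := by
      apply Subtype.ext
      funext v
      rw [schrodingerSB_piTransl_apply, coe_piBallSB, indicator_piPrimePowBall_add_eq le_rfl v hx]
    have h := hT (piTransl x) (piBallSB F ι N)
    rw [e] at h
    have h' := congr_arg (fun w : SchwartzBruhat (ι → F) => (w : (ι → F) → ℂ) u) h
    rw [schrodingerSB_piTransl_apply] at h'
    exact h'.symm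
  -- conclusion
  apply Subtype.ext
  funext u
  rw [Submodule.coe_smul, Pi.smul_apply, smul_eq_mul, coe_piBallSB]
  by_cases hu : u ∈ piPrimePowBall F ι N
  · rw [Set.indicator_of_mem hu, mul_one]
    have := h3 u hu 0
    rwa [zero_add] at this
  · rw [Set.indicator_of_notMem hu, mul_zero]
    exact h2 u hu

/-- **`T Φ = c_N Φ` for every `(𝔭^N)^ι`-invariant `Φ ∈ 𝒮(F^ι)`**, by the step decomposition and translation.
[cite: MoeglinVignerasWaldspurger1987, Chap. 2 I.3] -/
theorem commutant_eq_smul_of_forall_add_eq_pi {m : ℤ} (hm : ψ.HasConductorExp m)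
    (T : SchwartzBruhat (ι → F) →ₗ[ℂ] SchwartzBruhat (ι → F))
    (hT : ∀ (h : Heisenberg (polar (dotProductBilin F F (m := ι)))) (f : SchwartzBruhat (ι → F)),
      T (schrodingerSB (dotProductBilin F F) ψ hl hb h f) = schrodingerSB (dotProductBilin F F) ψ hl hb h (T f))
    {N : ℤ} (f : SchwartzBruhat (ι → F))
    (hf : ∀ x, ∀ t ∈ piPrimePowBall F ι N, (f : (ι → F) → ℂ) (x + t) = (f : (ι → F) → ℂ) x) :
    T f = ((T (piBallSB F ι N) : SchwartzBruhat (ι → F)) : (ι → F) → ℂ) 0 • f := by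
  classical
  set c : ℂ := ((T (piBallSB F ι N) : SchwartzBruhat (ι → F)) : (ι → F) → ℂ) 0 with hc_def
  have hχ : T (piBallSB F ι N) = c • piBallSB F ι N := by rw [hc_def]; exact commutant_piBallSB hl hb hm T hT N
  obtain ⟨C, hC, hsum⟩ := exists_finset_eq_sum_indicator_pi f.2 N
  choose rep hrep using hC
  -- the pieces `1_B Φ = Φ(a_B) • ρ(-a_B, 0, 0) 1_{(𝔭^N)^ι}`
  have key : ∀ (B : Set (ι → F)) (hB : B ∈ C) (u : ι → F), B.indicator (f : (ι → F) → ℂ) u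
      = ((((f : (ι → F) → ℂ) (rep B hB)) •
          schrodingerSB (dotProductBilin F F) ψ hl hb (piTransl (-(rep B hB))) (piBallSB F ι N)
          : SchwartzBruhat (ι → F)) : (ι → F) → ℂ) u := by
    intro B hB u
    rw [indicator_vadd_piPrimePowBall_eq hf (hrep B hB) u, Submodule.coe_smul, Pi.smul_apply, smul_eq_mul,
      schrodingerSB_piTransl_apply, coe_piBallSB]
    congr 1
    by_cases hu : u ∈ B
    · have hu' : u ∈ rep B hB +ᵥ piPrimePowBall F ι N := by rw [← hrep B hB]; exact hu
      rw [mem_vadd_piPrimePowBall_iff, sub_eq_add_neg] at hu'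
      rw [Set.indicator_of_mem hu, Set.indicator_of_mem hu']
    · have hu' : u ∉ rep B hB +ᵥ piPrimePowBall F ι N := by rw [← hrep B hB]; exact hu
      rw [mem_vadd_piPrimePowBall_iff, sub_eq_add_neg] at hu'
      rw [Set.indicator_of_notMem hu, Set.indicator_of_notMem hu']
  have hf' : f = ∑ B ∈ C.attach, ((f : (ι → F) → ℂ) (rep B.1 B.2)) •
      schrodingerSB (dotProductBilin F F) ψ hl hb (piTransl (-(rep B.1 B.2))) (piBallSB F ι N) := by
    apply Subtype.ext
    rw [AddSubmonoidClass.coe_finsetSum]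
    funext u
    rw [hsum u, Finset.sum_apply, ← Finset.sum_attach C (fun B => B.indicator (f : (ι → F) → ℂ) u)]
    exact Finset.sum_congr rfl fun B _ => key B.1 B.2 u
  rw [hf', map_sum, Finset.smul_sum]
  refine Finset.sum_congr rfl fun B _ => ?_
  rw [map_smul, hT, hχ, map_smul, smul_comm]

/-- **the commutant of the smooth Schrödinger model on `𝒮(F^ι)` is `ℂ`**: every `ℂ`-linear endomorphism of
`𝒮(F^ι)` commuting with all `ρ(h)` is a scalar. [cite: MoeglinVignerasWaldspurger1987, Chap. 2 I.3] -/
theorem commutant_schrodingerSB_pi (hψ : ψ.IsContinuousNontrivial)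
    (T : SchwartzBruhat (ι → F) →ₗ[ℂ] SchwartzBruhat (ι → F))
    (hT : ∀ (h : Heisenberg (polar (dotProductBilin F F (m := ι)))) (f : SchwartzBruhat (ι → F)),
      T (schrodingerSB (dotProductBilin F F) ψ hl hb h f) = schrodingerSB (dotProductBilin F F) ψ hl hb h (T f)) :
    ∃ c : ℂ, ∀ f : SchwartzBruhat (ι → F), T f = c • f := by
  obtain ⟨m, hm⟩ := hψ.exists_hasConductorExp
  refine ⟨((T (piBallSB F ι 0) : SchwartzBruhat (ι → F)) : (ι → F) → ℂ) 0, fun f => ?_⟩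
  obtain ⟨N₀, hN₀⟩ := exists_forall_add_eq_of_mem_schwartzBruhat_pi f.2
  have hfN := forall_add_eq_of_le_pi (le_max_left N₀ 0) hN₀
  rw [commutant_eq_smul_of_forall_add_eq_pi hl hb hm T hT f hfN]
  congr 1
  -- `c_N = c_0`: apply the same to `1_{𝒪^ι}`, which is `(𝔭^N)^ι`-invariant (`N ≥ 0`)
  have h0 : ∀ x, ∀ t ∈ piPrimePowBall F ι (max N₀ 0),
      ((piBallSB F ι 0 : SchwartzBruhat (ι → F)) : (ι → F) → ℂ) (x + t) =
        ((piBallSB F ι 0 : SchwartzBruhat (ι → F)) : (ι → F) → ℂ) x :=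
    fun x t ht => indicator_piPrimePowBall_add_eq (le_max_right N₀ 0) x ht
  have h := commutant_eq_smul_of_forall_add_eq_pi hl hb hm T hT (piBallSB F ι 0) h0
  have h' := congr_arg (fun w : SchwartzBruhat (ι → F) => (w : (ι → F) → ℂ) 0) h
  simp only [Submodule.coe_smul, Pi.smul_apply, smul_eq_mul] at h'
  rw [coe_piBallSB, Set.indicator_of_mem (zero_mem_piPrimePowBall 0), mul_one] at h'
  exact h'.symm

/-! ## §2 Implementers are unique up to a scalar -/

/-- `𝒮(F^ι)` is non-trivial: `1_{𝒪^ι} ≠ 0`. [cite: WeilBNT1967, Ch. VII §2, Def. 1] -/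
theorem piBallSB_zero_ne_zero : (piBallSB F ι 0 : SchwartzBruhat (ι → F)) ≠ 0 := by
  intro h
  have h' := congr_arg (fun w : SchwartzBruhat (ι → F) => (w : (ι → F) → ℂ) 0) h
  simp only [coe_piBallSB, Set.indicator_of_mem (zero_mem_piPrimePowBall 0), ZeroMemClass.coe_zero,
    Pi.zero_apply] at h'
  exact one_ne_zero h'

variable [Invertible (2 : F)]

/-- **MVW II.1 "`M` est unique à un scalaire près", KERNEL in rank `n`**: the predicate
`ImplementerUniqueUpToScalar` of `LocalWeilProjective.lean` holds for the smooth Schrödinger model on `𝒮(F^ι)`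
(`ψ` continuous non-trivial, `2` invertible). [cite: MoeglinVignerasWaldspurger1987, Chap. 2 II.1] -/
theorem implementerUniqueUpToScalar_schrodingerSB_pi (hψ : ψ.IsContinuousNontrivial) :
    ImplementerUniqueUpToScalar (schrodingerSB (dotProductBilin F F (m := ι)) ψ hl hb) := by
  intro g M M' hM hM'
  have hq := Implements.mul _ (Implements.inv _ hM) hM'
  rw [inv_mul_cancel] at hq
  have hT : ∀ (h : Heisenberg (polar (dotProductBilin F F (m := ι)))) (f : SchwartzBruhat (ι → F)),
      ((M⁻¹ * M' : SchwartzBruhat (ι → F) ≃ₗ[ℂ] SchwartzBruhat (ι → F)) :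
          SchwartzBruhat (ι → F) →ₗ[ℂ] SchwartzBruhat (ι → F))
          (schrodingerSB (dotProductBilin F F) ψ hl hb h f)
        = schrodingerSB (dotProductBilin F F) ψ hl hb h
          (((M⁻¹ * M' : SchwartzBruhat (ι → F) ≃ₗ[ℂ] SchwartzBruhat (ι → F)) :
            SchwartzBruhat (ι → F) →ₗ[ℂ] SchwartzBruhat (ι → F)) f) := by
    intro h f
    have := hq h f
    rwa [Heisenberg.PseudoSymplectic.act_one] at this
  obtain ⟨c, hc⟩ := commutant_schrodingerSB_pi hl hb hψ _ hT
  simp only [LinearEquiv.coe_coe] at hc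
  have hc0 : c ≠ 0 := by
    intro h0
    have h1 := hc (piBallSB F ι 0)
    rw [h0, zero_smul, ← (M⁻¹ * M').map_zero] at h1
    exact piBallSB_zero_ne_zero ((M⁻¹ * M').injective h1)
  refine ⟨Units.mk0 c hc0, fun f => ?_⟩
  rw [Units.val_mk0]
  calc M' f = M ((M⁻¹ * M') f) := by
          rw [LinearEquiv.mul_apply, LinearEquiv.coe_inv, LinearEquiv.apply_symm_apply]
    _ = M (c • f) := by rw [hc f]
    _ = (c : ℂ) • M f := map_smul M c f

/-- **`ker p = im i` for the smooth Schrödinger model on `𝒮(F^ι)`, KERNEL.** [cite: MoeglinVignerasWaldspurger1987, Chap. 2 II.1 (B)] -/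
theorem ker_proj_eq_range_ofScalar_schrodingerSB_pi (hψ : ψ.IsContinuousNontrivial) :
    (MpPsi.proj (schrodingerSB (dotProductBilin F F (m := ι)) ψ hl hb)).ker
      = (MpPsi.ofScalar (schrodingerSB (dotProductBilin F F (m := ι)) ψ hl hb)).range :=
  MpPsi.ker_proj_eq_range_ofScalar _ (implementerUniqueUpToScalar_schrodingerSB_pi hl hb hψ)

end Commutant

end Literature.RepresentationTheory.HeisenbergGroup
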